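import Summits.BirchSwinnertonDyer.BirchSwinnertonDyer.Theorems.KatoDescentTamePotSupersingularCartanMuRoadDoorsTprimeFive
import Summits.BirchSwinnertonDyer.BirchSwinnertonDyer.Theorems.KatoDescentPotSupersingularWildFineSelmerSupersingularCMAnchor
import Literature.NumberTheory.EllipticCurves.FineSelmerRankEqualityRoad
import HarnessLib

/-!
# Routes `KatoDescentTamePotSupersingular` (K8-t′, cell (t′)) and `KatoDescentPotSupersingular` (K9, cell O6 wild 3): U₀ FROM THE RANK EQUALITY
# `rank_p Cl(ℚ(E[p])^{⟨σ̄_s⟩}) = rank_p Cl(ℚ(E[p])^{⟨σ̄_m, σ̄_s⟩})` — image-agnostic doors, NO `μ`-hypothesis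

Seat `bsd-potss-k8t-c4` g25; `--supports stmt-BirchSwinnertonDyer-19982 --as helper` (the wild door bears on K9 item 19197 in the same way). THEOREMS ONLY
(no definition, no named fact, no `sorry`); nothing booked; (A), Conjecture A and BSD are proved for NO curve here; items 19202 / 19982 / 19189 / 19197 stay
OPEN at class level.

The Literature road `CoatesSujatha2005.RankEqualityRoad.conjA_of_rankEq` (p727907-series, same seat) gives statement (A) at `(E, p)` — `p` odd,
`p ∤ #Gal(ℚ(E[p])/ℚ)`, basis data `σ_s ↦ S` (first row `(1,0)`), `σ_m ↦ −1`, `σ_x ↦ X` (`X₀₁ ≠ 0`), the rank equality at LAYER 0 and `σ̄_m ∈ I(𝔮|p)` — with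
NO classical `μ`-hypothesis.  This file composes it with the two U₀-from-(A) doors of the cell:
* `missingUpperBoundAt_tame_of_rankEq` — (t′) rows at any odd `p` (`CartanMuRoadDoorsTprimeFive.missingUpperBoundAt_tame_of_conjA`, modulo `hKatoA hGZK hmod`);
* `missingUpperBoundAt_wild_three_of_rankEq` — K9 rows (`ClassO6 E 3`, `E[3]` irreducible with `3 ∤ #Gal(ℚ(E[3])/ℚ)`;
  `WildFineSelmerSupersingularCMAnchor.missingUpperBoundAt_wild_of_conjA`, modulo `hKatoA hGZK hmod`).
Per-row use: supply the basis data of the row's image (e.g. `C_ns⁺(5)`: `σ_s = diag(1,4)`, `σ_m = σ_x¹²`; `G₉ ⊂ 5S4`: `σ_m = σ_w²`; `N_ns(3)` of order 16 at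
`p = 3`), the two class numbers mod `p` (degree `#G/2` and `#G/4` fields, LAYER 0 only) and the ramification index `e(𝔮|p)` certificate for `σ̄_m ∈ I(𝔮)`.

References: [Kato2004Asterisque] Thm. 14.5 (3); [CoatesSujatha2005] Thm. 3.4; [Iwasawa1956]; [Kobayashi2003]; [PollackRubin2004].
-/

set_option autoImplicit false
set_option linter.dupNamespace false

noncomputable section

open scoped Classical NumberField Matrix
open WeierstrassCurve Field IntermediateField
  Literature.NumberTheory.EllipticCurves Literature.NumberTheory.EllipticCurves.Rank1Residual
  Literature.NumberTheory.EllipticCurves.Rank1Residual.Typed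
  Literature.NumberTheory.GaloisRepresentations
  Literature.NumberTheory.IwasawaTheory
  Literature.NumberTheory.EllipticCurves.CoatesSujatha2005.RankEqualityRoad
  Summit.BirchSwinnertonDyer.Rank1Residual Summit.BirchSwinnertonDyer.Rank1Residual.Additive
  Summit.BirchSwinnertonDyer.BirchSwinnertonDyer.Theorems

namespace Summit.BirchSwinnertonDyer.BirchSwinnertonDyer.Theorems.RankEqConjAUpperDoors

/-- **U₀ at a rank-`0` (t′) row FROM THE RANK EQUALITY (any odd `p`, any image of order prime to `p`)** — `MissingUpperBoundAt E p` modulo the named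
facts `hKatoA hGZK hmod`, from Cremona's `r_an = 0`, `Addv E p`, `SubTprime E p`, `E[p]` irreducible, `p ∤ #Gal(ℚ(E[p])/ℚ)`, the basis data
(`σ_s ↦ S` with first row `(1,0)`, `σ_m ↦ −1`, `σ_x ↦ X` with `X₀₁ ≠ 0`), the rank equality `#Cl(ℚ(E[p])^{⟨σ̄_s⟩})[p] = #Cl(ℚ(E[p])^{⟨σ̄_m,σ̄_s⟩})[p]` and
`σ̄_m ∈ I(𝔮|p)`.  NO `μ`-hypothesis.  CONDITIONAL; nothing booked; BSD for no curve.
[cite: Kato2004Asterisque, Thm. 14.5 (3) (p. 236)] [cite: CoatesSujatha2005, §3 Thm. 3.4] [cite: Iwasawa1956, §§3–5] -/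
theorem missingUpperBoundAt_tame_of_rankEq (W : WeierstrassCurve ℚ) [W.IsElliptic] [W.IsGloballyMinimal]
    (hKatoA : Kato2004.rankZero_padicValNat_sha_add_padicValNat_tamagawa_le_of_additive_potGood_of_irreducible_of_fineSelmerDual_fg)
    (hGZK : rank_eq_analyticRank_of_analyticRank_le_one) (hmod : hasEntireLFunction_rat) (p : ℕ) [Fact p.Prime] (hp2 : p ≠ 2)
    (hr : W.analyticRank = 0) (hadd : Addv W p) (hT : SubTprime W p) (hirr : W.HasIrreducibleModPGaloisRep p)
    (hG : ¬ p ∣ Nat.card (↥(W.divisionField p) ≃ₐ[ℚ] ↥(W.divisionField p)))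
    (e : W.geomTorsion p ≃+ (Fin 2 → ZMod p)) (σs σm σx : absoluteGaloisGroup ℚ)
    {S : Matrix (Fin 2) (Fin 2) (ZMod p)} (hS0 : S 0 0 = 1) (hS1 : S 0 1 = 0)
    (hσs : ∀ P : W.geomTorsion p, e (σs • P) = S *ᵥ e P)
    (hσm : ∀ P : W.geomTorsion p, e (σm • P) = -e P)
    {X : Matrix (Fin 2) (Fin 2) (ZMod p)} (hX : X 0 1 ≠ 0) (hσx : ∀ P : W.geomTorsion p, e (σx • P) = X *ᵥ e P)
    (hrank : Nat.card {d : ClassGroup (𝓞 ↥(fixedField (Subgroup.zpowers (absRestrictNormalHom (W.divisionField p) σs)))) // d ^ p = 1} =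
      Nat.card {d : ClassGroup (𝓞 ↥(fixedField (Subgroup.zpowers (absRestrictNormalHom (W.divisionField p) σm) ⊔
        Subgroup.zpowers (absRestrictNormalHom (W.divisionField p) σs)))) // d ^ p = 1})
    (hcI : ∀ (𝔮 : Ideal (𝓞 ↥(W.divisionField p))) [𝔮.IsMaximal], ((p : ℕ) : 𝓞 ↥(W.divisionField p)) ∈ 𝔮 →
      absRestrictNormalHom (W.divisionField p) σm ∈ 𝔮.inertia _) :
    MissingUpperBoundAt W p :=
  CartanMuRoadDoorsTprimeFive.missingUpperBoundAt_tame_of_conjA W hKatoA hGZK hmod p hr hp2 hadd hT hirr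
    (conjA_of_rankEq W hp2 hG e σs σm σx hS0 hS1 hσs hσm hX hσx hrank hcI)

/-- **U₀ at a rank-`0` K9 row (`ClassO6 E 3`) FROM THE RANK EQUALITY** — `MissingUpperBoundAt E 3` modulo `hKatoA hGZK hmod`, from Cremona's `r_an = 0`,
`ClassO6 E 3`, `E[3]` irreducible, `3 ∤ #Gal(ℚ(E[3])/ℚ)` (image of order prime to `3`, e.g. inside the normaliser of a non-split Cartan of `GL₂(𝔽₃)`),
the basis data, the rank equality `#Cl(ℚ(E[3])^{⟨σ̄_s⟩})[3] = #Cl(ℚ(E[3])^{⟨σ̄_m,σ̄_s⟩})[3]` and `σ̄_m ∈ I(𝔮|3)`.  NO `μ`-hypothesis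
(`WildFineSelmerSupersingularCMAnchor.missingUpperBoundAt_wild_of_conjA` ∘ the Literature road).  CONDITIONAL; nothing booked; BSD for no curve.
[cite: Kato2004Asterisque, Thm. 14.5 (3) (p. 236)] [cite: CoatesSujatha2005, §3 Thm. 3.4] [cite: Iwasawa1956, §§3–5] -/
theorem missingUpperBoundAt_wild_three_of_rankEq (W : WeierstrassCurve ℚ) [W.IsElliptic] [W.IsGloballyMinimal]
    (hKatoA : Kato2004.rankZero_padicValNat_sha_add_padicValNat_tamagawa_le_of_additive_potGood_of_irreducible_of_fineSelmerDual_fg)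
    (hGZK : rank_eq_analyticRank_of_analyticRank_le_one) (hmod : hasEntireLFunction_rat) [Fact (3 : ℕ).Prime]
    (hr : W.analyticRank = 0) (hO : ClassO6 W 3) (hirr : W.HasIrreducibleModPGaloisRep 3)
    (hG : ¬ 3 ∣ Nat.card (↥(W.divisionField 3) ≃ₐ[ℚ] ↥(W.divisionField 3)))
    (e : W.geomTorsion (3 : ℕ) ≃+ (Fin 2 → ZMod 3)) (σs σm σx : absoluteGaloisGroup ℚ)
    {S : Matrix (Fin 2) (Fin 2) (ZMod 3)} (hS0 : S 0 0 = 1) (hS1 : S 0 1 = 0)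
    (hσs : ∀ P : W.geomTorsion (3 : ℕ), e (σs • P) = S *ᵥ e P)
    (hσm : ∀ P : W.geomTorsion (3 : ℕ), e (σm • P) = -e P)
    {X : Matrix (Fin 2) (Fin 2) (ZMod 3)} (hX : X 0 1 ≠ 0) (hσx : ∀ P : W.geomTorsion (3 : ℕ), e (σx • P) = X *ᵥ e P)
    (hrank : Nat.card {d : ClassGroup (𝓞 ↥(fixedField (Subgroup.zpowers (absRestrictNormalHom (W.divisionField 3) σs)))) // d ^ 3 = 1} =
      Nat.card {d : ClassGroup (𝓞 ↥(fixedField (Subgroup.zpowers (absRestrictNormalHom (W.divisionField 3) σm) ⊔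
        Subgroup.zpowers (absRestrictNormalHom (W.divisionField 3) σs)))) // d ^ 3 = 1})
    (hcI : ∀ (𝔮 : Ideal (𝓞 ↥(W.divisionField 3))) [𝔮.IsMaximal], ((3 : ℕ) : 𝓞 ↥(W.divisionField 3)) ∈ 𝔮 →
      absRestrictNormalHom (W.divisionField 3) σm ∈ 𝔮.inertia _) :
    MissingUpperBoundAt W 3 :=
  WildFineSelmerSupersingularCMAnchor.missingUpperBoundAt_wild_of_conjA hKatoA hGZK hmod W hr hO hirr
    (conjA_of_rankEq W (by decide) hG e σs σm σx hS0 hS1 hσs hσm hX hσx hrank hcI)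

end Summit.BirchSwinnertonDyer.BirchSwinnertonDyer.Theorems.RankEqConjAUpperDoors

end
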